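import Mathlib
import Summits.ResolutionOfSingularities.ResolutionOfSingularities.Theorems.WeightedConstruction.Negative.K1WildOrbitFace

/-!
# K1 wild orbit, residue FIELD instance: `y = Y ∈ 𝔽₂(Y)` is not a square, so the `z⁴`-coefficient obstruction holds over `κ(𝔫) = 𝔽₂(Y)`
  (res-L1-w43-tri-1, TRIAGE v9.7 §21.15 (D)/(E); sequel of `…Negative.K1WildOrbitFace`)

[OURS · L1 W4.3 · crux `WeightedConstruction` (stmt-0571) / door `HypersurfaceCentreConstruction` (stmt-19897) · small-model facts, def-free;
AI-written, weaker than expert review; no statement of the manuscript under review is used or formalised.]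

The orbit-generic prime `𝔫 = (u, x, z)` of the exact-`(5,2,2)` chart of `K1 = x² + y⁷ + y·z⁴` (and of the isolated variant `K1′ = K1 + z⁹`)
over `𝔽₂` has residue field `κ(𝔫) = 𝔽₂(Y)` (the orbit coordinate `Y` is a unit at `𝔫`).  `not_isSquare_ratFuncX`: `Y` is not a square in
`𝔽₂(Y)` (degree parity).  `k1_face_coeff_ne_zero_residueField`: hence, by `K1WildOrbitFace.face_coeff_ne_zero`, for EVERY power series
`φ ∈ 𝔽₂(Y)⟦u, z⟧` and every remainder `ρ` without `z⁴`-term, the `z⁴`-coefficient of `φ² + Y·z⁴ + Y⁷·u⁴ + ρ` is non-zero — the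
coefficient core of the bound `a₂(B_𝔫) ≤ 4 < 5` (σ drops `5/2 → 2` at the wild orbit; res-type-060's K-WILD-HOM memo §4 reaches the same
conclusion «√Y ∉ 𝔽₂(Y)» independently).  Index convention as in the parent file: `0 = z`, `1 = u`.  [folklore]-level algebra.
-/

set_option linter.dupNamespace false

namespace Summit.ResolutionOfSingularities.ResolutionOfSingularities.Theorems.WeightedConstruction.Negative.K1WildOrbitFaceField

open MvPowerSeries Finsupp K1WildOrbitFace

/-- `Y ∈ 𝔽₂(Y)` is not a square: `intDegree` is additive and `intDegree Y = 1` is odd. [folklore] -/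
theorem not_isSquare_ratFuncX : ¬ IsSquare (RatFunc.X : RatFunc (ZMod 2)) := by
  rintro ⟨q, hq⟩
  have hq0 : q ≠ 0 := by
    rintro rfl
    exact RatFunc.X_ne_zero (K := ZMod 2) (by rw [hq, mul_zero])
  have h := congrArg RatFunc.intDegree hq
  rw [RatFunc.intDegree_X, RatFunc.intDegree_mul hq0 hq0] at h
  omega

/-- **K1 / K1′ at the `μ₂`-orbit over the residue field `𝔽₂(Y)`**: for every `φ, ρ ∈ 𝔽₂(Y)⟦u, z⟧` with `coeff_{z⁴} ρ = 0`,
`coeff_{z⁴} (φ² + Y·z⁴ + Y⁷·u⁴ + ρ) ≠ 0`. [folklore] -/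
theorem k1_face_coeff_ne_zero_residueField (φ ρ : MvPowerSeries (Fin 2) (RatFunc (ZMod 2)))
    (hρ : coeff (single 0 4) ρ = 0) :
    coeff (single 0 4) (φ ^ 2 + C RatFunc.X * X 0 ^ 4 + C (RatFunc.X ^ 7) * X 1 ^ 4 + ρ) ≠ 0 :=
  face_coeff_ne_zero not_isSquare_ratFuncX φ ρ hρ

/-- In particular for K1 (ρ = 0). [folklore] -/
theorem k1_face_coeff_ne_zero_residueField_zero (φ : MvPowerSeries (Fin 2) (RatFunc (ZMod 2))) :
    coeff (single 0 4) (φ ^ 2 + C RatFunc.X * X 0 ^ 4 + C (RatFunc.X ^ 7) * X 1 ^ 4) ≠ 0 := by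
  simpa using k1_face_coeff_ne_zero_residueField φ 0 (by simp)

/-- In particular for K1′ (ρ = u⁸·z⁹, the strict transform of z⁹). [folklore] -/
theorem k1prime_face_coeff_ne_zero_residueField (φ : MvPowerSeries (Fin 2) (RatFunc (ZMod 2))) :
    coeff (single 0 4) (φ ^ 2 + C RatFunc.X * X 0 ^ 4 + C (RatFunc.X ^ 7) * X 1 ^ 4 + X 1 ^ 8 * X 0 ^ 9) ≠ 0 :=
  k1_face_coeff_ne_zero_residueField φ _ coeff_z4_u8z9

end Summit.ResolutionOfSingularities.ResolutionOfSingularities.Theorems.WeightedConstruction.Negative.K1WildOrbitFaceField
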